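import Mathlib.FieldTheory.Finite.Basic
import HarnessLib

/-!
# The Hermitian curve `y^q + y = x^{q+1}` over `𝔽_{q²}` has `q³ + 1` rational points

For a prime power `q`, the Hermitian function field `H = 𝔽_{q²}(x, y)`, `y^q + y = x^{q+1}`
(Stichtenoth, *Algebraic Function Fields and Codes*, Lemma 6.4.4 = Lemma VI.4.4 of the 1993
edition) has genus `g = q(q−1)/2` and exactly `q³ + 1` places of degree one over `𝔽_{q²}`:
the common pole `Q_∞` of `x` and `y`, and, "for each `α ∈ 𝔽_{q²}` there are `q` elements
`β ∈ 𝔽_{q²}` such that `β^q + β = α^{q+1}`", one place `P_{α,β}` for each such pair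
[Stichtenoth2009, Lemma 6.4.4 (b)]. Consequently `N = q³ + 1 = q² + 1 + 2g·q`, i.e. `H` attains
the Hasse–Weil upper bound: it is a *maximal* function field [Stichtenoth2009, Lemma 6.4.4 (c)].

This file proves the elementary heart of (b) for an arbitrary finite field `F` with `#F = q²`
(so `q` is automatically a power of the characteristic):

* `pow_q_add_pow_q_fixed` — if `β^q + β = c` then `c^q = c` (the map `β ↦ β^q + β` is the trace
  to the subfield `𝔽_q = {c : c^q = c}`);
* `card_hermitianFibre_eq` — for every `c` with `c^q = c` there are exactly `q` elements `β ∈ F`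
  with `β^q + β = c` (proof: `(X^q + X − c)^q − (X^q + X − c) = X^{q²} − X` in `F[X]`, so
  `X^q + X − c` divides `∏_{a ∈ F} (X − a)` and has `q` distinct roots in `F`);
* `card_hermitianFibre_eq_zero` — and none when `c^q ≠ c`;
* `card_hermitianFibre_norm` — in particular `q` of them for `c = α^{q+1}` (`α^{q+1} = N(α) ∈ 𝔽_q`),
  which is Lemma 6.4.4 (b)(2) as printed;
* `card_hermitianAffinePoints` — hence `#{(α, β) ∈ F² : β^q + β = α^{q+1}} = q³`, so that with
  the one place at infinity `N(H) = q³ + 1`;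
* `hermitian_count_eq_hasseWeil_bound` — the arithmetic identity
  `q³ + 1 = q² + 1 + 2·(q(q−1)/2)·q` (the Hasse–Weil bound `q_F + 1 + 2g√q_F` with `q_F = q²`,
  `g = q(q−1)/2` is attained: maximality, Lemma 6.4.4 (c) given (a)).

Not here: the genus computation (a), the uniqueness of the place above each affine point and of
`Q_∞` (valuation theory of `H`, Stichtenoth Prop. 6.4.1), and the `L`-polynomial
`L_H(T) = (1 + qT)^{2g}` of a maximal curve (Stichtenoth (6.25)), which needs the Hasse–Weil
theorem.
-/

namespace Literature.AlgebraicGeometry.FiniteFields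

open Polynomial Finset

section Hermitian

variable {F : Type*} [Field F] [Fintype F]

/-- If `#F = q²` then `q = p^m` for the characteristic `p` of `F`. [folklore] -/
private theorem exists_char_pow_eq_of_card_eq_sq {q : ℕ} (hF : Fintype.card F = q ^ 2) :
    ∃ p m : ℕ, p.Prime ∧ CharP F p ∧ q = p ^ m := by
  obtain ⟨p, hchar, n, hp, hcard⟩ := FiniteField.card' F
  have hdvd : q ∣ p ^ (n : ℕ) := by
    rw [← hcard, hF, sq]
    exact Dvd.intro q rfl
  obtain ⟨m, -, hm⟩ := (Nat.dvd_prime_pow hp).mp hdvd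
  exact ⟨p, m, hp, hchar, hm⟩

/-- `1 < q` when `#F = q²` (a field has at least two elements). [folklore] -/
private theorem one_lt_of_card_eq_sq {q : ℕ} (hF : Fintype.card F = q ^ 2) : 1 < q := by
  have h1 : 1 < Fintype.card F := Fintype.one_lt_card
  rw [hF] at h1
  rcases Nat.lt_or_ge 1 q with h | h
  · exact h
  · interval_cases q <;> simp_all

/-- Frobenius additivity at the exponent `q`: `(x + y)^q = x^q + y^q` when `#F = q²`. [folklore] -/
private theorem add_pow_sqrtCard {q : ℕ} (hF : Fintype.card F = q ^ 2) (x y : F) :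
    (x + y) ^ q = x ^ q + y ^ q := by
  obtain ⟨p, m, hp, hchar, rfl⟩ := exists_char_pow_eq_of_card_eq_sq hF
  haveI := Fact.mk hp
  exact add_pow_char_pow x y p m

/-- `x^{q²} = x` on `F` when `#F = q²`. [folklore] -/
private theorem pow_sq_sqrtCard {q : ℕ} (hF : Fintype.card F = q ^ 2) (x : F) :
    x ^ q ^ 2 = x := by
  rw [← hF]; exact FiniteField.pow_card x

/-- The image of `β ↦ β^q + β` lies in the fixed field of `x ↦ x^q` (the trace
`𝔽_{q²} → 𝔽_q`): if `β^q + β = c` then `c^q = c`. [cite: Stichtenoth2009, Lemma 6.4.4 (b)] -/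
theorem pow_q_add_pow_q_fixed {q : ℕ} (hF : Fintype.card F = q ^ 2) (β : F) :
    (β ^ q + β) ^ q = β ^ q + β := by
  rw [add_pow_sqrtCard hF, ← pow_mul, ← sq, pow_sq_sqrtCard hF, add_comm]

/-- The norm-type element `α^{q+1}` is fixed by `x ↦ x^q`. [folklore] -/
private theorem norm_pow_q_fixed {q : ℕ} (hF : Fintype.card F = q ^ 2) (α : F) :
    (α ^ (q + 1)) ^ q = α ^ (q + 1) := by
  rw [← pow_mul, show (q + 1) * q = q ^ 2 + q by ring, pow_add, pow_sq_sqrtCard hF, pow_succ']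

/-- Key polynomial identity in `F[X]`: for `c` with `c^q = c`,
`(X^q + X − c)^q − (X^q + X − c) = X^{q²} − X`. [folklore] -/
private theorem hermitianPoly_pow_sub {q : ℕ} (hF : Fintype.card F = q ^ 2) {c : F}
    (hc : c ^ q = c) :
    (X ^ q + X - C c : F[X]) ^ q - (X ^ q + X - C c) = X ^ (q ^ 2) - X := by
  obtain ⟨p, m, hp, hchar, rfl⟩ := exists_char_pow_eq_of_card_eq_sq hF
  haveI := Fact.mk hp
  rw [sub_pow_char_pow, add_pow_char_pow, ← pow_mul, ← sq, ← C_pow, hc]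
  ring

/-- For `c` in the fixed field `{c : c^q = c} = 𝔽_q` there are exactly `q` elements `β ∈ F` with
`β^q + β = c` (the trace `𝔽_{q²} → 𝔽_q` is surjective with fibres of size `q`).
[cite: Stichtenoth2009, Lemma 6.4.4 (b)] -/
theorem card_hermitianFibre_eq [DecidableEq F] {q : ℕ} (hF : Fintype.card F = q ^ 2) {c : F}
    (hc : c ^ q = c) : #{β : F | β ^ q + β = c} = q := by
  have hq : 1 < q := one_lt_of_card_eq_sq hF
  set u : F[X] := X ^ q + X - C c with hu_def
  -- degree and non-vanishing of u
  have hu_deg : u.natDegree = q := by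
    rw [hu_def, natDegree_sub_C, natDegree_add_eq_left_of_natDegree_lt] <;>
      simp [hq]
  have hu0 : u ≠ 0 := by
    intro h; rw [h, natDegree_zero] at hu_deg; omega
  -- u divides v = X^{q²} − X, whose roots are all of F, each simple
  set v : F[X] := X ^ (q ^ 2) - X with hv_def
  have hq2 : 1 < q ^ 2 := Nat.one_lt_pow two_ne_zero hq
  have hv0 : v ≠ 0 := FiniteField.X_pow_card_sub_X_ne_zero F hq2
  have hv_deg : v.natDegree = q ^ 2 := FiniteField.X_pow_card_sub_X_natDegree_eq F hq2
  have hv_roots : v.roots = (univ : Finset F).val := by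
    rw [hv_def, ← hF]; exact FiniteField.roots_X_pow_card_sub_X F
  have hdvd : u ∣ v := by
    refine ⟨u ^ (q - 1) - 1, ?_⟩
    have := hermitianPoly_pow_sub hF hc
    rw [← hv_def] at this
    rw [← this, mul_sub, mul_one, ← pow_succ']
    congr 2
    omega
  obtain ⟨w, hw⟩ := hdvd
  have hw0 : w ≠ 0 := by
    rintro rfl; rw [mul_zero] at hw; exact hv0 hw
  -- counting roots: card roots u + card roots w = q² = deg u + deg w, each card ≤ deg
  have hcard_v : Multiset.card v.roots = q ^ 2 := by
    rw [hv_roots]; simpa using hF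
  have hroots_mul : v.roots = u.roots + w.roots := by
    rw [hw]; exact roots_mul (hw ▸ hv0)
  have hdeg_mul : v.natDegree = u.natDegree + w.natDegree := by
    rw [hw]; exact natDegree_mul hu0 hw0
  have hcu := card_roots' u
  have hcw := card_roots' w
  have hcard_u : Multiset.card u.roots = q := by
    have : Multiset.card u.roots + Multiset.card w.roots = q ^ 2 := by
      rw [← Multiset.card_add, ← hroots_mul, hcard_v]
    omega
  -- roots of u are simple (u.roots ≤ v.roots = univ, which is nodup)
  have hnodup : u.roots.Nodup := by
    have hle : u.roots ≤ v.roots := roots.le_of_dvd hv0 ⟨w, hw⟩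
    rw [hv_roots] at hle
    exact Multiset.nodup_of_le hle univ.nodup
  -- identify the fibre with the root set of u
  have hfib : ({β : F | β ^ q + β = c} : Finset F) = u.roots.toFinset := by
    ext β
    rw [mem_filter, Multiset.mem_toFinset, mem_roots hu0, IsRoot.def]
    simp [hu_def, sub_eq_zero]
  rw [hfib, Multiset.toFinset_card_of_nodup hnodup, hcard_u]

/-- Outside the fixed field the fibre is empty: if `c^q ≠ c` no `β` has `β^q + β = c`.
[cite: Stichtenoth2009, Lemma 6.4.4 (b)] -/
theorem card_hermitianFibre_eq_zero [DecidableEq F] {q : ℕ} (hF : Fintype.card F = q ^ 2)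
    {c : F} (hc : c ^ q ≠ c) : #{β : F | β ^ q + β = c} = 0 := by
  rw [Finset.card_eq_zero, filter_eq_empty_iff]
  intro β _ hβ
  exact hc (by rw [← hβ]; exact pow_q_add_pow_q_fixed hF β)

/-- **Stichtenoth, Lemma 6.4.4 (b)(2)**: for each `α ∈ 𝔽_{q²}` there are exactly `q` elements
`β ∈ 𝔽_{q²}` with `β^q + β = α^{q+1}`. [cite: Stichtenoth2009, Lemma 6.4.4 (b)] -/
theorem card_hermitianFibre_norm [DecidableEq F] {q : ℕ} (hF : Fintype.card F = q ^ 2)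
    (α : F) :
    #{β : F | β ^ q + β = α ^ (q + 1)} = q :=
  card_hermitianFibre_eq hF (norm_pow_q_fixed hF α)

/-- The affine Hermitian curve `y^q + y = x^{q+1}` has exactly `q³` points over a field with `q²`
elements; with the unique place `Q_∞` at infinity this is `N(H) = q³ + 1`.
[cite: Stichtenoth2009, Lemma 6.4.4 (b)] -/
theorem card_hermitianAffinePoints [DecidableEq F] {q : ℕ} (hF : Fintype.card F = q ^ 2) :
    Fintype.card {P : F × F // P.2 ^ q + P.2 = P.1 ^ (q + 1)} = q ^ 3 := by
  rw [Fintype.card_subtype, card_filter, ← univ_product_univ, sum_product]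
  have h : ∀ α : F, (∑ β : F, if β ^ q + β = α ^ (q + 1) then 1 else 0) =
      #{β : F | β ^ q + β = α ^ (q + 1)} := fun α => by
    rw [card_filter]
  simp_rw [h, card_hermitianFibre_norm hF, sum_const, card_univ, hF, smul_eq_mul]
  ring

/-- Maximality arithmetic [cite: Stichtenoth2009, Lemma 6.4.4 (c)]: with `q_F = q²` and
`g = q(q−1)/2` (Lemma 6.4.4 (a)), `q³ + 1 = q_F + 1 + 2g·√q_F`, i.e. the Hermitian curve meets
the Hasse–Weil upper bound `N ≤ q_F + 1 + 2g√q_F`. -/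
theorem hermitian_count_eq_hasseWeil_bound (q : ℕ) :
    q ^ 3 + 1 = q ^ 2 + 1 + 2 * (q * (q - 1) / 2) * q := by
  rw [Nat.mul_div_cancel' (Nat.even_mul_pred_self q).two_dvd]
  rcases q with _ | q
  · simp
  · simp only [Nat.add_sub_cancel]
    ring

end Hermitian

end Literature.AlgebraicGeometry.FiniteFields
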